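import Literature.MathematicalPhysics.StatisticalMechanics.BarlowStackingEnergy

/-!
# `PeriodicGivenLayered` (stmt-AtomisticToContinuum-11779), line `Sketch`, helper for stub `stub_layerCake`:
# lattice-sum bounds (decay of the layer sums, part 1: the inverse-cube sum over a shifted triangular layer)

Support file for the crux `PhononSlackCertificates.PeriodicGivenLayered` (= `HullMinimality.PeriodicGivenLayered`).
Elementary real analysis, no potential yet: for `a ∈ [47/50, 1]`, `|H| ≥ 7/10` and any letter offset `δ`, every
finite partial sum of `((‖layerVec a H δ 1 p q‖ ^ 2)⁻¹) ^ 3 = (ρ_{pq}² + H²)⁻³` over `(p, q) ∈ ℤ²` is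
`≤ 192 / H ^ 4` (`cake_sum_layer_inv_cube_le`). Route: `(X + Y)³ ≥ 3 X Y²` separates the two lattice directions,
a shift lemma (`cake_sum_shift_le`) reduces a sum over `p ∈ ℤ` of an even antitone function of `p + c` to twice a
sum over `ℕ`, and the two one-dimensional sums `∑ (α n² + H²/2)⁻¹ ≤ 8/|H|`, `∑ ((β n² + H²/2)⁻¹)² ≤ 18/|H|³` are
bounded by counting the terms `n < ⌈|H|⌉` and telescoping the others.
-/

namespace Summit.AtomisticToContinuum.Crystallization.Theorems.LayeredHull

open Finset
open Literature.MathematicalPhysics.StatisticalMechanics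

/-! ## One-dimensional sums -/

/-- Telescoping: `∑_{n ∈ [M, N)} (1/n - 1/(n+1)) ≤ 1/M` for `1 ≤ M`. [folklore] -/
theorem cake_sum_Ico_telescope_le (M N : ℕ) (hM : 1 ≤ M) :
    ∑ n ∈ Ico M N, ((1 : ℝ) / n - 1 / (n + 1)) ≤ 1 / M := by
  rcases le_total N M with hNM | hMN
  · rw [Finset.Ico_eq_empty_of_le hNM, sum_empty]
    positivity
  · rw [Finset.sum_Ico_eq_sum_range]
    have key : ∀ K : ℕ, ∑ k ∈ range K, ((1 : ℝ) / ((M + k : ℕ) : ℝ) - 1 / (((M + k : ℕ) : ℝ) + 1)) =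
        1 / M - 1 / ((M : ℝ) + K) := by
      intro K
      induction K with
      | zero => simp
      | succ K ih =>
        rw [sum_range_succ, ih]
        push_cast
        ring
    rw [key (N - M)]
    have : (0 : ℝ) ≤ 1 / ((M : ℝ) + (N - M : ℕ)) := by positivity
    linarith

/-- `∑_{n < N} (α n² + H²/2)⁻¹ ≤ 8 / |H|` for `α ≥ 22/25`, `|H| ≥ 7/10`. [folklore] -/
theorem cake_sum_inv_le (α H : ℝ) (hα : 22 / 25 ≤ α) (hH : 7 / 10 ≤ |H|) (N : ℕ) :
    ∑ n ∈ range N, (α * (n : ℝ) ^ 2 + H ^ 2 / 2)⁻¹ ≤ 8 / |H| := by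
  set t : ℝ := |H| with ht
  have htpos : 0 < t := by linarith
  have hH2 : H ^ 2 = t ^ 2 := (sq_abs H).symm
  set M : ℕ := ⌈t⌉₊ with hM
  have hM1 : t ≤ M := Nat.le_ceil _
  have hM2 : (M : ℝ) < t + 1 := Nat.ceil_lt_add_one htpos.le
  have hMpos : 1 ≤ M := Nat.ceil_pos.2 htpos
  have hb1 : ∀ n : ℕ, (α * (n : ℝ) ^ 2 + H ^ 2 / 2)⁻¹ ≤ 2 / t ^ 2 := by
    intro n
    rw [hH2, inv_eq_one_div, div_le_div_iff₀ (by positivity) (by positivity)]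
    nlinarith [sq_nonneg (n : ℝ), sq_nonneg t]
  have hb2 : ∀ n : ℕ, 1 ≤ n → (α * (n : ℝ) ^ 2 + H ^ 2 / 2)⁻¹ ≤ 2 / α * (1 / n - 1 / (n + 1)) := by
    intro n hn
    have hn' : (1 : ℝ) ≤ n := by exact_mod_cast hn
    have hαpos : 0 < α := by linarith
    have e : 2 / α * (1 / (n : ℝ) - 1 / (n + 1)) = 1 / (α * n * (n + 1) / 2) := by
      field_simp
      ring
    rw [e, inv_eq_one_div]
    apply one_div_le_one_div_of_le (by positivity)
    rw [hH2]
    nlinarith [mul_nonneg hαpos.le (mul_nonneg (Nat.cast_nonneg n) (sub_nonneg.2 hn')), sq_nonneg t]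
  -- the first `M` terms
  have hfirst : ∀ K : ℕ, K ≤ M →
      ∑ n ∈ range K, (α * (n : ℝ) ^ 2 + H ^ 2 / 2)⁻¹ ≤ 34 / 7 / t := by
    intro K hK
    calc ∑ n ∈ range K, (α * (n : ℝ) ^ 2 + H ^ 2 / 2)⁻¹ ≤ ∑ _n ∈ range K, 2 / t ^ 2 :=
          sum_le_sum fun n _ => hb1 n
      _ = K * (2 / t ^ 2) := by rw [sum_const, card_range, nsmul_eq_mul]
      _ ≤ (t + 1) * (2 / t ^ 2) := by
          gcongr
          exact le_trans (by exact_mod_cast hK) hM2.le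
      _ = 2 * (t + 1) / t ^ 2 := by ring
      _ ≤ 34 / 7 / t := by
          rw [div_le_div_iff₀ (by positivity) (by positivity)]
          nlinarith
  rcases le_total N M with hNM | hMN
  · calc _ ≤ 34 / 7 / t := hfirst N hNM
      _ ≤ 8 / t := by gcongr; norm_num
  · rw [← Finset.sum_range_add_sum_Ico _ hMN]
    have hsecond : ∑ n ∈ Ico M N, (α * (n : ℝ) ^ 2 + H ^ 2 / 2)⁻¹ ≤ 25 / 11 / t := by
      calc ∑ n ∈ Ico M N, (α * (n : ℝ) ^ 2 + H ^ 2 / 2)⁻¹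
          ≤ ∑ n ∈ Ico M N, 2 / α * (1 / n - 1 / (n + 1)) :=
            sum_le_sum fun n hn => hb2 n (le_trans hMpos (Finset.mem_Ico.1 hn).1)
        _ = 2 / α * ∑ n ∈ Ico M N, ((1 : ℝ) / n - 1 / (n + 1)) := by rw [mul_sum]
        _ ≤ 2 / α * (1 / M) :=
            mul_le_mul_of_nonneg_left (cake_sum_Ico_telescope_le M N hMpos) (by positivity)
        _ ≤ 2 / α * (1 / t) := by gcongr
        _ = (2 / α) / t := by ring
        _ ≤ 25 / 11 / t := by
            have hαpos : 0 < α := by linarith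
            have : 2 / α ≤ 25 / 11 := by
              rw [div_le_div_iff₀ hαpos (by norm_num)]; linarith
            exact div_le_div_of_nonneg_right this htpos.le
    calc _ ≤ 34 / 7 / t + 25 / 11 / t := add_le_add (hfirst M le_rfl) hsecond
      _ ≤ 8 / t := by
          rw [← add_div]
          gcongr
          norm_num

/-- `∑_{n < N} ((β n² + H²/2)⁻¹)² ≤ 18 / |H|³` for `β ≥ 33/50`, `|H| ≥ 7/10`. [folklore] -/
theorem cake_sum_inv_sq_le (β H : ℝ) (hβ : 33 / 50 ≤ β) (hH : 7 / 10 ≤ |H|) (N : ℕ) :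
    ∑ n ∈ range N, ((β * (n : ℝ) ^ 2 + H ^ 2 / 2)⁻¹) ^ 2 ≤ 18 / |H| ^ 3 := by
  set t : ℝ := |H| with ht
  have htpos : 0 < t := by linarith
  have hH2 : H ^ 2 = t ^ 2 := (sq_abs H).symm
  set M : ℕ := ⌈t⌉₊ with hM
  have hM1 : t ≤ M := Nat.le_ceil _
  have hM2 : (M : ℝ) < t + 1 := Nat.ceil_lt_add_one htpos.le
  have hMpos : 1 ≤ M := Nat.ceil_pos.2 htpos
  have hβpos : 0 < β := by linarith
  have hb1 : ∀ n : ℕ, ((β * (n : ℝ) ^ 2 + H ^ 2 / 2)⁻¹) ^ 2 ≤ 4 / t ^ 4 := by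
    intro n
    have h1 : (β * (n : ℝ) ^ 2 + H ^ 2 / 2)⁻¹ ≤ 2 / t ^ 2 := by
      rw [hH2, inv_eq_one_div, div_le_div_iff₀ (by positivity) (by positivity)]
      nlinarith [sq_nonneg (n : ℝ), sq_nonneg t]
    have h0 : 0 ≤ (β * (n : ℝ) ^ 2 + H ^ 2 / 2)⁻¹ := by positivity
    calc ((β * (n : ℝ) ^ 2 + H ^ 2 / 2)⁻¹) ^ 2 ≤ (2 / t ^ 2) ^ 2 := pow_le_pow_left₀ h0 h1 2
      _ = 4 / t ^ 4 := by ring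
  have hb2 : ∀ n : ℕ, 1 ≤ n →
      ((β * (n : ℝ) ^ 2 + H ^ 2 / 2)⁻¹) ^ 2 ≤ 4 / (β * t ^ 2) * (1 / n - 1 / (n + 1)) := by
    intro n hn
    have hn' : (1 : ℝ) ≤ n := by exact_mod_cast hn
    have h1 : (β * (n : ℝ) ^ 2 + H ^ 2 / 2)⁻¹ ≤ 2 / t ^ 2 := by
      rw [hH2, inv_eq_one_div, div_le_div_iff₀ (by positivity) (by positivity)]
      nlinarith [sq_nonneg (n : ℝ), sq_nonneg t]
    have h2 : (β * (n : ℝ) ^ 2 + H ^ 2 / 2)⁻¹ ≤ 2 / β * (1 / n - 1 / (n + 1)) := by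
      have e : 2 / β * (1 / (n : ℝ) - 1 / (n + 1)) = 1 / (β * n * (n + 1) / 2) := by
        field_simp
        ring
      rw [e, inv_eq_one_div]
      apply one_div_le_one_div_of_le (by positivity)
      rw [hH2]
      nlinarith [mul_nonneg hβpos.le (mul_nonneg (Nat.cast_nonneg n) (sub_nonneg.2 hn')), sq_nonneg t]
    have h0 : 0 ≤ (β * (n : ℝ) ^ 2 + H ^ 2 / 2)⁻¹ := by positivity
    calc ((β * (n : ℝ) ^ 2 + H ^ 2 / 2)⁻¹) ^ 2
        = (β * (n : ℝ) ^ 2 + H ^ 2 / 2)⁻¹ * (β * (n : ℝ) ^ 2 + H ^ 2 / 2)⁻¹ := sq _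
      _ ≤ (2 / t ^ 2) * (2 / β * (1 / n - 1 / (n + 1))) :=
          mul_le_mul h1 h2 h0 (by positivity)
      _ = 4 / (β * t ^ 2) * (1 / n - 1 / (n + 1)) := by ring
  have hfirst : ∀ K : ℕ, K ≤ M →
      ∑ n ∈ range K, ((β * (n : ℝ) ^ 2 + H ^ 2 / 2)⁻¹) ^ 2 ≤ 10 / t ^ 3 := by
    intro K hK
    calc ∑ n ∈ range K, ((β * (n : ℝ) ^ 2 + H ^ 2 / 2)⁻¹) ^ 2 ≤ ∑ _n ∈ range K, 4 / t ^ 4 :=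
          sum_le_sum fun n _ => hb1 n
      _ = K * (4 / t ^ 4) := by rw [sum_const, card_range, nsmul_eq_mul]
      _ ≤ (t + 1) * (4 / t ^ 4) := by
          gcongr
          exact le_trans (by exact_mod_cast hK) hM2.le
      _ = 4 * (t + 1) / t ^ 4 := by ring
      _ ≤ 10 / t ^ 3 := by
          rw [div_le_div_iff₀ (by positivity) (by positivity)]
          have h7 : 4 * (t + 1) ≤ 10 * t := by linarith
          calc 4 * (t + 1) * t ^ 3 ≤ 10 * t * t ^ 3 := by gcongr
            _ = 10 * t ^ 4 := by ring
  rcases le_total N M with hNM | hMN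
  · calc _ ≤ 10 / t ^ 3 := hfirst N hNM
      _ ≤ 18 / t ^ 3 := by gcongr; norm_num
  · rw [← Finset.sum_range_add_sum_Ico _ hMN]
    have hsecond : ∑ n ∈ Ico M N, ((β * (n : ℝ) ^ 2 + H ^ 2 / 2)⁻¹) ^ 2 ≤ 200 / 33 / t ^ 3 := by
      calc ∑ n ∈ Ico M N, ((β * (n : ℝ) ^ 2 + H ^ 2 / 2)⁻¹) ^ 2
          ≤ ∑ n ∈ Ico M N, 4 / (β * t ^ 2) * (1 / n - 1 / (n + 1)) :=
            sum_le_sum fun n hn => hb2 n (le_trans hMpos (Finset.mem_Ico.1 hn).1)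
        _ = 4 / (β * t ^ 2) * ∑ n ∈ Ico M N, ((1 : ℝ) / n - 1 / (n + 1)) := by rw [mul_sum]
        _ ≤ 4 / (β * t ^ 2) * (1 / M) :=
            mul_le_mul_of_nonneg_left (cake_sum_Ico_telescope_le M N hMpos) (by positivity)
        _ ≤ 4 / (β * t ^ 2) * (1 / t) := by gcongr
        _ = (4 / β) / t ^ 3 := by ring
        _ ≤ 200 / 33 / t ^ 3 := by
            have : 4 / β ≤ 200 / 33 := by
              rw [div_le_div_iff₀ hβpos (by norm_num)]
              linarith
            exact div_le_div_of_nonneg_right this (by positivity)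
    calc _ ≤ 10 / t ^ 3 + 200 / 33 / t ^ 3 := add_le_add (hfirst M le_rfl) hsecond
      _ ≤ 18 / t ^ 3 := by
          rw [← add_div]
          gcongr
          norm_num

/-! ## Sums over a shifted copy of `ℤ` -/

/-- Reindexing bound: if `ι` is injective on `P` with `ι p ≤ |x p|`, then for `G ≥ 0` antitone on `[0, ∞)`,
`∑_{p ∈ P} G ((x p)²) ≤ sup_N ∑_{n < N} G (n²)`. [folklore] -/
theorem cake_sum_le_of_index (G : ℝ → ℝ) (hG0 : ∀ s, 0 ≤ s → 0 ≤ G s)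
    (hG : ∀ s s', 0 ≤ s → s ≤ s' → G s' ≤ G s) {B : ℝ}
    (hB : ∀ N : ℕ, ∑ n ∈ range N, G ((n : ℝ) ^ 2) ≤ B) (P : Finset ℤ) (x : ℤ → ℝ) (ι : ℤ → ℕ)
    (hinj : Set.InjOn ι P) (hle : ∀ p ∈ P, (ι p : ℝ) ≤ |x p|) :
    ∑ p ∈ P, G ((x p) ^ 2) ≤ B := by
  classical
  obtain ⟨N, hN⟩ := (P.image ι).exists_nat_subset_range
  calc ∑ p ∈ P, G ((x p) ^ 2) ≤ ∑ p ∈ P, G (((ι p : ℕ) : ℝ) ^ 2) := by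
        refine Finset.sum_le_sum fun p hp => hG _ _ (by positivity) ?_
        rw [← sq_abs (x p)]
        exact pow_le_pow_left₀ (Nat.cast_nonneg _) (hle p hp) 2
    _ = ∑ n ∈ P.image ι, G ((n : ℝ) ^ 2) :=
        (Finset.sum_image (f := fun n : ℕ => G ((n : ℝ) ^ 2)) hinj).symm
    _ ≤ ∑ n ∈ range N, G ((n : ℝ) ^ 2) :=
        Finset.sum_le_sum_of_subset_of_nonneg hN fun _ _ _ => hG0 _ (by positivity)
    _ ≤ B := hB N

/-- **Shift lemma.** For `G ≥ 0` antitone on `[0, ∞)` with `∑_{n < N} G (n²) ≤ B` for all `N`, and any real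
shift `c`, every finite sum `∑_{p ∈ P ⊆ ℤ} G ((p + c)²)` is `≤ 2 B` (split `p + c ≥ 0` / `< 0` and reindex each
half injectively into `ℕ` without increasing `|p + c|`). [folklore] -/
theorem cake_sum_shift_le (G : ℝ → ℝ) (hG0 : ∀ s, 0 ≤ s → 0 ≤ G s)
    (hG : ∀ s s', 0 ≤ s → s ≤ s' → G s' ≤ G s) {B : ℝ}
    (hB : ∀ N : ℕ, ∑ n ∈ range N, G ((n : ℝ) ^ 2) ≤ B) (c : ℝ) (P : Finset ℤ) :
    ∑ p ∈ P, G (((p : ℝ) + c) ^ 2) ≤ 2 * B := by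
  classical
  set p₀ : ℤ := ⌈-c⌉ with hp₀
  have hc₀ : -c ≤ p₀ := Int.le_ceil _
  have hc₁ : (p₀ : ℝ) < -c + 1 := Int.ceil_lt_add_one _
  rw [← Finset.sum_filter_add_sum_filter_not P (fun p : ℤ => 0 ≤ (p : ℝ) + c), two_mul]
  refine add_le_add ?_ ?_
  · refine cake_sum_le_of_index G hG0 hG hB _ (fun p : ℤ => (p : ℝ) + c)
      (fun p : ℤ => (p - p₀).toNat) ?_ ?_
    · intro p hp q hq hpq
      have hp' : p₀ ≤ p := Int.ceil_le.2 (by linarith [(Finset.mem_filter.1 hp).2])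
      have hq' : p₀ ≤ q := Int.ceil_le.2 (by linarith [(Finset.mem_filter.1 hq).2])
      have h := congrArg (fun n : ℕ => (n : ℤ)) hpq
      simp only [Int.toNat_of_nonneg (sub_nonneg.2 hp'), Int.toNat_of_nonneg (sub_nonneg.2 hq')] at h
      linarith
    · intro p hp
      have hpc : 0 ≤ (p : ℝ) + c := (Finset.mem_filter.1 hp).2
      have hp' : p₀ ≤ p := Int.ceil_le.2 (by linarith)
      have hcast : (((p - p₀).toNat : ℕ) : ℝ) = ((p - p₀ : ℤ) : ℝ) := by
        exact_mod_cast Int.toNat_of_nonneg (sub_nonneg.2 hp')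
      rw [hcast, abs_of_nonneg hpc]
      push_cast
      linarith
  · refine cake_sum_le_of_index G hG0 hG hB _ (fun p : ℤ => (p : ℝ) + c)
      (fun p : ℤ => (p₀ - 1 - p).toNat) ?_ ?_
    · intro p hp q hq hpq
      have hp1 : (p : ℝ) + c < 0 := not_le.1 (Finset.mem_filter.1 hp).2
      have hq1 : (q : ℝ) + c < 0 := not_le.1 (Finset.mem_filter.1 hq).2
      have hp' : p < p₀ := by exact_mod_cast (show (p : ℝ) < p₀ by linarith)
      have hq' : q < p₀ := by exact_mod_cast (show (q : ℝ) < p₀ by linarith)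
      have h := congrArg (fun n : ℕ => (n : ℤ)) hpq
      simp only [Int.toNat_of_nonneg (show (0 : ℤ) ≤ p₀ - 1 - p by omega),
        Int.toNat_of_nonneg (show (0 : ℤ) ≤ p₀ - 1 - q by omega)] at h
      linarith
    · intro p hp
      have hp1 : (p : ℝ) + c < 0 := not_le.1 (Finset.mem_filter.1 hp).2
      have hp' : p < p₀ := by exact_mod_cast (show (p : ℝ) < p₀ by linarith)
      have hcast : (((p₀ - 1 - p).toNat : ℕ) : ℝ) = ((p₀ - 1 - p : ℤ) : ℝ) := by
        exact_mod_cast Int.toNat_of_nonneg (show (0 : ℤ) ≤ p₀ - 1 - p by omega)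
      rw [hcast, abs_of_neg hp1]
      push_cast
      linarith

/-! ## The two-dimensional layer sum -/

/-- `‖layerVec a H δ 1 p q‖²` in coordinates: `a² (p + q/2 + δ/2)² + (3a²/4) (q + δ/3)² + H²`. [folklore] -/
theorem cake_norm_layerVec_sq (a H : ℝ) (δ p q : ℤ) :
    ‖layerVec a H δ 1 p q‖ ^ 2 =
      a ^ 2 * ((p : ℝ) + ((q : ℝ) / 2 + (δ : ℝ) / 2)) ^ 2 +
        3 * a ^ 2 / 4 * ((q : ℝ) + (δ : ℝ) / 3) ^ 2 + H ^ 2 := by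
  rw [norm_layerVec, Real.sq_sqrt (by positivity)]
  have h3 : (√3 : ℝ) ^ 2 = 3 := Real.sq_sqrt (by norm_num)
  push_cast
  linear_combination (a ^ 2 * ((q : ℝ) + (δ : ℝ) / 3) ^ 2 / 4) * h3

/-- The algebraic separation step: `((X + Y)⁻¹)³ ≤ (1/3) X⁻¹ (Y⁻¹)²` for `X, Y > 0`
(from `(X + Y)³ ≥ 3 X Y²`). [folklore] -/
theorem cake_inv_add_cube_le {X Y : ℝ} (hX : 0 < X) (hY : 0 < Y) :
    ((X + Y)⁻¹) ^ 3 ≤ 1 / 3 * (X⁻¹ * (Y⁻¹) ^ 2) := by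
  rw [inv_pow, inv_pow, show 1 / 3 * (X⁻¹ * (Y ^ 2)⁻¹) = (3 * X * Y ^ 2)⁻¹ by
    rw [mul_inv, mul_inv]; ring]
  apply inv_anti₀ (by positivity)
  nlinarith [pow_pos hX 3, mul_pos (mul_pos hX hX) hY, pow_pos hY 3]

/-- **The inverse-cube layer sum.** For `a ∈ [47/50, 1]`, `|H| ≥ 7/10`, any offset `δ` and any finite
`u ⊆ ℤ²`: `∑_{(p,q) ∈ u} (‖layerVec a H δ 1 p q‖²)⁻³ ≤ 192 / H⁴`. [folklore] -/
theorem cake_sum_layer_inv_cube_le (a H : ℝ) (ha : 47 / 50 ≤ a) (ha1 : a ≤ 1) (hH : 7 / 10 ≤ |H|)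
    (δ : ℤ) (u : Finset (ℤ × ℤ)) :
    ∑ pq ∈ u, ((‖layerVec a H δ 1 pq.1 pq.2‖ ^ 2)⁻¹) ^ 3 ≤ 192 / H ^ 4 := by
  classical
  have _ := ha1
  have htpos : 0 < |H| := by linarith
  have hH2 : 0 < H ^ 2 := by rw [← sq_abs]; positivity
  have ha2 : 22 / 25 ≤ a ^ 2 := by nlinarith
  -- the two one-dimensional weights
  set X : ℤ → ℤ → ℝ := fun p q => a ^ 2 * ((p : ℝ) + ((q : ℝ) / 2 + (δ : ℝ) / 2)) ^ 2 + H ^ 2 / 2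
    with hX
  set Y : ℤ → ℝ := fun q => 3 * a ^ 2 / 4 * ((q : ℝ) + (δ : ℝ) / 3) ^ 2 + H ^ 2 / 2 with hY
  have hXpos : ∀ p q, 0 < X p q := fun p q => by positivity
  have hYpos : ∀ q, 0 < Y q := fun q => by positivity
  have hsplit : ∀ pq : ℤ × ℤ, ‖layerVec a H δ 1 pq.1 pq.2‖ ^ 2 = X pq.1 pq.2 + Y pq.2 := by
    intro pq; rw [cake_norm_layerVec_sq]; ring
  -- inner sums over `p` and the outer sum over `q`
  have hinner : ∀ (q : ℤ) (P : Finset ℤ), ∑ p ∈ P, (X p q)⁻¹ ≤ 2 * (8 / |H|) := by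
    intro q P
    have key := cake_sum_shift_le (fun s => (a ^ 2 * s + H ^ 2 / 2)⁻¹) (B := 8 / |H|)
      (fun s hs => by positivity) (fun s s' hs hss' => ?_) (fun N => ?_) ((q : ℝ) / 2 + (δ : ℝ) / 2) P
    · simpa only [hX] using key
    · exact inv_anti₀ (by positivity) (by nlinarith)
    · have := cake_sum_inv_le (a ^ 2) H ha2 hH N
      simpa only [mul_comm] using this
  have houter : ∀ Q : Finset ℤ, ∑ q ∈ Q, ((Y q)⁻¹) ^ 2 ≤ 2 * (18 / |H| ^ 3) := by
    intro Q
    have hβ : 33 / 50 ≤ 3 * a ^ 2 / 4 := by nlinarith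
    have key := cake_sum_shift_le (fun s => ((3 * a ^ 2 / 4 * s + H ^ 2 / 2)⁻¹) ^ 2) (B := 18 / |H| ^ 3)
      (fun s _ => sq_nonneg _) (fun s s' hs hss' => ?_) (fun N => ?_) ((δ : ℝ) / 3) Q
    · simpa only [hY] using key
    · have h0 : 0 < 3 * a ^ 2 / 4 * s + H ^ 2 / 2 := by positivity
      have hs' : 0 ≤ s' := hs.trans hss'
      have h0' : 0 < 3 * a ^ 2 / 4 * s' + H ^ 2 / 2 := by positivity
      exact pow_le_pow_left₀ (inv_pos.2 h0').le (inv_anti₀ h0 (by nlinarith)) 2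
    · exact cake_sum_inv_sq_le (3 * a ^ 2 / 4) H hβ hH N
  -- assemble
  have hH4 : |H| * |H| ^ 3 = H ^ 4 := by
    rw [show |H| * |H| ^ 3 = |H| ^ 4 by ring, pow_abs, abs_of_nonneg (by positivity)]
  calc ∑ pq ∈ u, ((‖layerVec a H δ 1 pq.1 pq.2‖ ^ 2)⁻¹) ^ 3
      ≤ ∑ pq ∈ u, 1 / 3 * ((X pq.1 pq.2)⁻¹ * ((Y pq.2)⁻¹) ^ 2) :=
        Finset.sum_le_sum fun pq _ => by rw [hsplit]; exact cake_inv_add_cube_le (hXpos _ _) (hYpos _)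
    _ ≤ ∑ pq ∈ (u.image Prod.fst) ×ˢ (u.image Prod.snd), 1 / 3 * ((X pq.1 pq.2)⁻¹ * ((Y pq.2)⁻¹) ^ 2) := by
        refine Finset.sum_le_sum_of_subset_of_nonneg Finset.subset_product fun pq _ _ => ?_
        have := hXpos pq.1 pq.2
        positivity
    _ = ∑ q ∈ u.image Prod.snd, 1 / 3 * ((Y q)⁻¹) ^ 2 * ∑ p ∈ u.image Prod.fst, (X p q)⁻¹ := by
        rw [Finset.sum_product_right]
        refine Finset.sum_congr rfl fun q _ => ?_
        rw [Finset.mul_sum]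
        exact Finset.sum_congr rfl fun p _ => by ring
    _ ≤ ∑ q ∈ u.image Prod.snd, 1 / 3 * ((Y q)⁻¹) ^ 2 * (2 * (8 / |H|)) := by
        refine Finset.sum_le_sum fun q _ => ?_
        exact mul_le_mul_of_nonneg_left (hinner q _) (by positivity)
    _ = 1 / 3 * (2 * (8 / |H|)) * ∑ q ∈ u.image Prod.snd, ((Y q)⁻¹) ^ 2 := by
        rw [Finset.mul_sum]
        exact Finset.sum_congr rfl fun q _ => by ring
    _ ≤ 1 / 3 * (2 * (8 / |H|)) * (2 * (18 / |H| ^ 3)) :=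
        mul_le_mul_of_nonneg_left (houter _) (by positivity)
    _ = 192 / H ^ 4 := by
        rw [← hH4]
        field_simp
        ring

end Summit.AtomisticToContinuum.Crystallization.Theorems.LayeredHull

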